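import Mathlib
import Summits.PneNP.PneNP.Theorems.SfmBlPipelineAux
import Summits.PneNP.PneNP.Theorems.SfmBlAssembly
import Summits.PneNP.PneNP.Theorems.SfmBlCutFromTrace

/-!
# The parametric pipeline theorem of the line «sfm-bl»: from a greedy signing to `CutCertified`
(PROOF-SFM-BL §6 end-to-end, PARAMETRIC in the algorithm's data — the twin of `exists_cutCertified` for
the machine closer of `CandCutNormSigningFP`, stmt-PneNP-20523)

FRONTIER F-N1c; nothing here bears on P vs NP.

`cutCertified_of_pipeline`: for a 3-local instance `I` with `0 < n`, `2^60·n ≤ m`, ANY piece structure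
(`src, dst, own₁, own₂` with the four compatibilities, leg-degrees `≤ 2^60`, `1 ≤ N ≤ 2n+1+6m/2^60` pieces),
parameters `j, b, t₀` with `N ≤ 2^b`, `2·2^{j+1} + 2b ≤ 10(t₀+1)`, `20N ≤ 2^{2^{j+1}}` (so `ℓ = 2^{j+2}` and
`t₀` may be `O(log N)`), ANY spot decomposition `(r, p, V₁, V₂)` satisfying the five clauses of
`exists_spot_decomposition` (graph = `bipGraph` of all legs, `γ_sp = 60√(6000·2^60)`, threshold `t₀`), the
part matrices `MpT T c i k = Σ_{e : i → k, p e = c} χ(T_{e.1})`, per-spot families `𝒲 s`, `bad s T` given by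
MEMBERSHIP characterisations, and the EXPLICIT potential
`F T = tr((fromBlocks 0 (MpT T none) (MpT T none)ᵀ 0)^{2^{j+2}}) / A₁ + ê(T) / A₃`,
`A₁ = 10·(N·(2^60/20)^{2^{j+2}} + 1)`, `ê(T) = Σ_s Σ_{W ∈ bad s T} #{legs of spot s meeting W}`,
`A₃ = (6/5)·(Q₀ + 1)`, `Q₀ = Σ_s 4(|V₁ s|+|V₂ s|)·((2^60)^10)⁻¹` (all rational given the data):
every GREEDY PATH `y` for `F` (hypothesis shape of `SfmBl.two_pow_smul_le_sum_of_greedy`) is cut-certified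
(`CandCutNorm.CutCertified I y`, written out).  Ingredients: `remainder_package_param`,
`spot_package_explicit`, `greedy_two_part_bounds`, `abs_cut_le_of_trace_pow_le`, `bilin_le_sum_of_parts`,
`cutCertified_of_matrix_cut_lt`.
-/

namespace Summit.PneNP.PneNP.Theorems.SfmBl

open Matrix Finset BigOperators Literature.Computability.Complexity
open Summit.PneNP.PneNP.Theorems.CandCutNorm

/-- **THE PARAMETRIC PIPELINE THEOREM** (see the module docstring). -/
theorem cutCertified_of_pipeline {n m : ℕ} (I : LocalMap 3 n m) (hn : 0 < n) (hm : 2 ^ 60 * n ≤ m)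
    {α β : Type} [Fintype α] [Fintype β] [DecidableEq α] [DecidableEq β]
    (src : Fin m × Fin 3 → α) (dst : Fin m × Fin 3 → β) (own₁ : α → Fin n) (own₂ : β → Option (Fin n))
    (hsrc : ∀ j ℓ, own₁ (src (j, ℓ)) = I.vars j 0) (hz : ∀ j, own₂ (dst (j, 0)) = none)
    (ha : ∀ j, own₂ (dst (j, 1)) = some (I.vars j 1)) (hb : ∀ j, own₂ (dst (j, 2)) = some (I.vars j 2))
    (hdeg₁ : ∀ i, (Finset.univ.filter fun e => src e = i).card ≤ 2 ^ 60)
    (hdeg₂ : ∀ k, (Finset.univ.filter fun e => dst e = k).card ≤ 2 ^ 60)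
    (hN1 : 1 ≤ Fintype.card α + Fintype.card β)
    (hN : ((Fintype.card α : ℝ) + Fintype.card β) ≤ 2 * n + 1 + 6 * m / 2 ^ 60)
    -- the exponent and threshold parameters
    (j b t₀ : ℕ) (hNb : ((Fintype.card α : ℝ) + Fintype.card β) ≤ 2 ^ b)
    (ht₀ : 2 * 2 ^ (j + 1) + 2 * b ≤ 10 * (t₀ + 1))
    (hj : 20 * ((Fintype.card α : ℝ) + Fintype.card β) ≤ 2 ^ (2 ^ (j + 1)))
    -- the spot decomposition (five clauses of `exists_spot_decomposition`)
    (r : ℕ) (p : Fin m × Fin 3 → Option (Fin r)) (V₁ : Fin r → Finset α) (V₂ : Fin r → Finset β)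
    (hsp : ∀ (W₁ : Finset α) (W₂ : Finset β),
      ((bipGraph (fun i k => ∃ e, src e = i ∧ dst e = k)).induce
          {x | Sum.elim (fun i => i ∈ W₁) (fun j => j ∈ W₂) x}).Connected →
      W₁.card + W₂.card ≤ t₀ →
      ((Finset.univ.filter fun e => p e = none ∧ src e ∈ W₁ ∧ dst e ∈ W₂).card : ℝ)
        ≤ (60 * Real.sqrt (6000 * 2 ^ 60)) * Real.sqrt ((W₁.card : ℝ) * (W₂.card : ℝ)))
    (hsides : ∀ s e, p e = some s → src e ∈ V₁ s ∧ dst e ∈ V₂ s)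
    (hdense : ∀ s, (60 * Real.sqrt (6000 * 2 ^ 60)) * Real.sqrt (((V₁ s).card : ℝ) * ((V₂ s).card : ℝ))
      < ((Finset.univ.filter fun e => p e = some s).card : ℝ))
    (hcov : ∀ s, (V₁ s).card + (V₂ s).card ≤ 2 * (Finset.univ.filter fun e => p e = some s).card)
    -- the part matrices
    (MpT : (Fin m → Bool) → Option (Fin r) → Matrix α β ℝ)
    (hMpT : ∀ T c i k, MpT T c i k = ∑ e ∈ Finset.univ.filter
      (fun e : Fin m × Fin 3 => src e = i ∧ dst e = k ∧ p e = c), ((boolSign (T e.1) : ℤ) : ℝ))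
    -- the spot families, by membership
    (𝒲 : Fin r → Finset (Finset α × Finset β))
    (h𝒲 : ∀ s W, W ∈ 𝒲 s ↔ W.1 ⊆ V₁ s ∧ W.2 ⊆ V₂ s ∧
      IsConnectedPair (fun i k => ∃ e : {e // p e = some s}, src e.1 = i ∧ dst e.1 = k) W.1 W.2)
    (bad : Fin r → (Fin m → Bool) → Finset (Finset α × Finset β))
    (hbad : ∀ s T W, W ∈ bad s T ↔ W ∈ 𝒲 s ∧
      Real.sqrt (6000 * 2 ^ 60) * Real.sqrt ((W.1.card : ℝ) * (W.2.card : ℝ))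
        < |∑ i ∈ W.1, ∑ k ∈ W.2, MpT T (some s) i k|)
    -- the explicit potential and a greedy path for it
    (F : (Fin m → Bool) → ℝ)
    (hF : ∀ T, F T =
      ((Matrix.fromBlocks 0 (MpT T none) (MpT T none)ᵀ 0) ^ (2 ^ (j + 2))).trace
          / (10 * (((Fintype.card α : ℝ) + Fintype.card β) * ((2 : ℝ) ^ 60 / 20) ^ (2 ^ (j + 2)) + 1))
        + (∑ s, ∑ W ∈ bad s T, ((Finset.univ.filter fun e : Fin m × Fin 3 =>
              (src e ∈ W.1 ∨ dst e ∈ W.2) ∧ p e = some s).card : ℝ))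
          / (6 / 5 * (∑ s, 4 * (((V₁ s).card : ℝ) + (V₂ s).card) * (((2 ^ 60 : ℕ) : ℝ) ^ 10)⁻¹ + 1)))
    (y : Fin m → Bool)
    (hgreedy : ∀ (k : ℕ) (hk : k < m),
      ∑ T' ∈ Finset.univ.filter (fun T' : Fin m → Bool => ∀ i : Fin m, (i : ℕ) < k + 1 → T' i = y i), F T'
        ≤ ∑ T' ∈ Finset.univ.filter
            (fun T' : Fin m → Bool => (∀ i : Fin m, (i : ℕ) < k → T' i = y i) ∧ T' ⟨k, hk⟩ ≠ y ⟨k, hk⟩),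
            F T') :
    ∀ (σ φ : Fin n → ℤ), (∀ i, σ i = 1 ∨ σ i = -1) → (∀ i, φ i = 1 ∨ φ i = -1) →
      ∑ j, boolSign (y j) * σ (I.vars j 0) * (1 + φ (I.vars j 1) + φ (I.vars j 2)) < (m : ℤ) := by
  classical
  -- the graph
  obtain ⟨Es, hEs⟩ : ∃ Es : α → β → Prop, Es = fun i k => ∃ e, src e = i ∧ dst e = k := ⟨_, rfl⟩
  haveI : DecidableRel (bipGraph Es).Adj := Classical.decRel _
  have hG : ∀ e, (bipGraph Es).Adj (Sum.inl (src e)) (Sum.inr (dst e)) := fun e =>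
    (bipGraph_adj_inl_inr Es _ _).2 (by rw [hEs]; exact ⟨e, rfl, rfl⟩)
  have hGdeg : ∀ x, (bipGraph Es).degree x ≤ 2 ^ 60 := by
    intro x; subst hEs; exact degree_bipGraph_le src dst hdeg₁ hdeg₂ x
  -- part matrices in subtype form
  have hMpT' : ∀ T c i k, MpT T c i k = ∑ e ∈ (Finset.univ : Finset {e // p e = c}).filter
      (fun e => src e.1 = i ∧ dst e.1 = k), ((boolSign (T e.1.1) : ℤ) : ℝ) := by
    intro T c i k
    rw [hMpT, sum_part_eq₂ p c (fun e => src e = i) (fun e => dst e = k) (fun e => ((boolSign (T e.1) : ℤ) : ℝ))]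
  ------------------------------------------------------------------
  -- the sparse remainder
  ------------------------------------------------------------------
  have hexp : 2 ^ (j + 2) = 2 * 2 ^ (j + 1) := by rw [pow_succ]; ring
  obtain ⟨hA₁r, hsum₁, hbudR⟩ := remainder_package_param
    (fun e : {e // p e = none} => src e.1) (fun e => dst e.1) (fun e => e.1.1)
    (fun j' => card_part_out_le_three p none j')
    (fun i => by
      rw [card_part_eq p none (fun e => src e = i)]
      exact le_trans (Finset.card_le_card fun e he => by
        simp only [Finset.mem_filter, Finset.mem_univ, true_and] at he ⊢; exact he.1) (hdeg₁ i))
    (fun k => by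
      rw [card_part_eq p none (fun e => dst e = k)]
      exact le_trans (Finset.card_le_card fun e he => by
        simp only [Finset.mem_filter, Finset.mem_univ, true_and] at he ⊢; exact he.1) (hdeg₂ k))
    (bipGraph Es) (fun e => hG e.1) hGdeg hn hm hN1 hN (2 ^ (j + 1)) b t₀ hNb ht₀ hj
    (fun W₁ W₂ hconn hsize => by
      rw [card_part_eq₂ p none (fun e => src e ∈ W₁) (fun e => dst e ∈ W₂)]
      rw [hEs] at hconn
      exact hsp W₁ W₂ hconn hsize)
    (fun T => MpT T none) (fun T i k => hMpT' T none i k)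
  rw [← hexp] at hA₁r hsum₁
  ------------------------------------------------------------------
  -- the spots
  ------------------------------------------------------------------
  have hL : 0 < (2 ^ 60 : ℕ) := Nat.pos_of_ne_zero (by norm_num)
  have hL2 : (2 : ℝ) ≤ ((2 ^ 60 : ℕ) : ℝ) := by norm_num
  have hγ'0 : (0 : ℝ) ≤ Real.sqrt (6000 * 2 ^ 60) := Real.sqrt_nonneg _
  have hγ'L : 144 * ((2 ^ 60 : ℕ) : ℝ) * Real.log ((2 ^ 60 : ℕ) : ℝ) ≤ (Real.sqrt (6000 * 2 ^ 60)) ^ 2 := by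
    have e : ((2 ^ 60 : ℕ) : ℝ) = (2 : ℝ) ^ 60 := by norm_num
    rw [e]; exact sfmBl_gamma'_sq_ge
  have hpack := fun s : Fin r => spot_package_explicit
    (fun e : {e // p e = some s} => src e.1) (fun e => dst e.1) (fun e => e.1.1) (V₁ s) (V₂ s)
    (fun e => hsides s e.1 e.2) (fun j' => card_part_out_le_three p (some s) j') hL
    (fun i => by
      rw [card_part_eq p (some s) (fun e => src e = i)]
      exact le_trans (Finset.card_le_card fun e he => by
        simp only [Finset.mem_filter, Finset.mem_univ, true_and] at he ⊢; exact he.1) (hdeg₁ i))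
    (fun k => by
      rw [card_part_eq p (some s) (fun e => dst e = k)]
      exact le_trans (Finset.card_le_card fun e he => by
        simp only [Finset.mem_filter, Finset.mem_univ, true_and] at he ⊢; exact he.1) (hdeg₂ k))
    hL2 hγ'0 hγ'L
    (by rw [card_part_univ p (some s)]; exact hdense s)
    (fun T => MpT T (some s)) (fun T i k => hMpT' T (some s) i k) (𝒲 s) (h𝒲 s) (bad s) (hbad s)
  -- the explicit `ê` in all-legs form
  have hmeet : ∀ (s : Fin r) (W : Finset α × Finset β),
      (((Finset.univ : Finset {e // p e = some s}).filter fun e => src e.1 ∈ W.1 ∨ dst e.1 ∈ W.2).card : ℝ)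
        = ((Finset.univ.filter fun e : Fin m × Fin 3 => (src e ∈ W.1 ∨ dst e ∈ W.2) ∧ p e = some s).card : ℝ) := by
    intro s W
    rw [card_part_eq p (some s) (fun e => src e ∈ W.1 ∨ dst e ∈ W.2)]
  obtain ⟨Lc, hLc⟩ : ∃ Lc : ℝ, Lc = (((2 ^ 60 : ℕ) : ℝ) ^ 10)⁻¹ := ⟨_, rfl⟩
  have hL10 : (0 : ℝ) ≤ Lc := by rw [hLc]; exact inv_nonneg.2 (pow_nonneg (Nat.cast_nonneg _) 10)
  have hLc_le : Lc ≤ (1 : ℝ) / 28800 := by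
    have hbig : (28800 : ℝ) ≤ ((2 ^ 60 : ℕ) : ℝ) ^ 10 := by
      have hcast : ((2 ^ 60 : ℕ) : ℝ) = (2 : ℝ) ^ 60 := by norm_num
      rw [hcast]
      calc (28800 : ℝ) ≤ (2 : ℝ) ^ 60 := by norm_num
        _ ≤ ((2 : ℝ) ^ 60) ^ 10 := le_self_pow₀ (by norm_num) (by norm_num)
    rw [hLc, inv_eq_one_div]
    exact one_div_le_one_div_of_le (by norm_num) hbig
  ------------------------------------------------------------------
  -- the potential
  ------------------------------------------------------------------
  obtain ⟨Q₀, hQ₀⟩ : ∃ Q₀ : ℝ,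
      Q₀ = ∑ s : Fin r, 4 * (((V₁ s).card : ℝ) + (V₂ s).card) * Lc := ⟨_, rfl⟩
  have hQ₀0 : 0 ≤ Q₀ := by
    rw [hQ₀]
    refine Finset.sum_nonneg fun s _ => mul_nonneg (mul_nonneg (by norm_num) ?_) hL10
    exact add_nonneg (Nat.cast_nonneg _) (Nat.cast_nonneg _)
  obtain ⟨A₁, hA₁def⟩ : ∃ A₁ : ℝ,
      A₁ = 10 * (((Fintype.card α : ℝ) + Fintype.card β) * ((2 : ℝ) ^ 60 / 20) ^ (2 ^ (j + 2)) + 1) :=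
    ⟨_, rfl⟩
  have hA₁ : 0 < A₁ := by
    rw [hA₁def]
    have : (0 : ℝ) ≤ ((Fintype.card α : ℝ) + Fintype.card β) * ((2 : ℝ) ^ 60 / 20) ^ (2 ^ (j + 2)) :=
      mul_nonneg (add_nonneg (Nat.cast_nonneg _) (Nat.cast_nonneg _)) (pow_nonneg (by norm_num) _)
    linarith only [this]
  let trR : (Fin m → Bool) → ℝ := fun T =>
    ((Matrix.fromBlocks 0 (MpT T none) (MpT T none)ᵀ 0) ^ (2 ^ (j + 2))).trace
  let hat : (Fin m → Bool) → ℝ := fun T => ∑ s, ∑ W ∈ bad s T,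
    (((Finset.univ : Finset {e // p e = some s}).filter fun e => src e.1 ∈ W.1 ∨ dst e.1 ∈ W.2).card : ℝ)
  have htr0 : ∀ T, 0 ≤ trR T := fun T => by
    show 0 ≤ ((Matrix.fromBlocks 0 (MpT T none) (MpT T none)ᵀ 0) ^ (2 ^ (j + 2))).trace
    rw [hexp]; exact trace_fromBlocks_pow_two_mul_nonneg _ _
  have hhat0 : ∀ T, 0 ≤ hat T := fun T =>
    Finset.sum_nonneg fun s _ => Finset.sum_nonneg fun W _ => Nat.cast_nonneg _
  have hsum₂ : ∑ T, hat T ≤ 2 ^ m * Q₀ := by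
    show ∑ T, ∑ s, ∑ W ∈ bad s T, _ ≤ 2 ^ m * Q₀
    rw [Finset.sum_comm, hQ₀, Finset.mul_sum]
    refine Finset.sum_le_sum fun s _ => ?_
    have := (hpack s).2
    rw [← hLc] at this
    exact this
  have hsum₁' : ∑ T, trR T ≤ 2 ^ m * (A₁ / 10) := by rw [hA₁def]; exact hsum₁
  have hF' : ∀ T, F T = trR T / A₁ + hat T / (6 / 5 * (Q₀ + 1)) := by
    intro T
    rw [hF T, hA₁def, hQ₀, hLc]
    simp only [trR, hat, hmeet]
  obtain ⟨htrA, hhatA⟩ :=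
    greedy_two_part_bounds trR hat F htr0 hhat0 hA₁ hQ₀0 hF' hsum₁' hsum₂ y hgreedy
  ------------------------------------------------------------------
  -- per-part cut bounds for `y`
  ------------------------------------------------------------------
  have hrr : (0 : ℝ) ≤ Real.sqrt 2 * ((2 : ℝ) ^ 60 / 20) := by positivity
  have htrace : ((Matrix.fromBlocks 0 (MpT y none) (MpT y none)ᵀ 0) ^ (2 ^ (j + 2))).trace
      ≤ (Real.sqrt 2 * ((2 : ℝ) ^ 60 / 20)) ^ (2 ^ (j + 2)) := by
    have h1 : trR y < A₁ := htrA
    rw [hA₁def] at h1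
    exact le_trans h1.le hA₁r
  have hR : ∀ (σ : α → ℝ) (φ : β → ℝ), (∀ i, σ i = 1 ∨ σ i = -1) → (∀ k, φ k = 1 ∨ φ k = -1) →
      σ ⬝ᵥ (MpT y none *ᵥ φ)
        ≤ ((Fintype.card α : ℝ) + Fintype.card β) * (Real.sqrt 2 * ((2 : ℝ) ^ 60 / 20)) / 2 := by
    intro σ φ hσ hφ
    exact (le_abs_self _).trans (abs_cut_le_of_trace_pow_le (MpT y none) σ φ hσ hφ j hrr htrace)
  let X : Option (Fin r) → ℝ := fun c =>
    match c with
    | none => ((Fintype.card α : ℝ) + Fintype.card β) * (Real.sqrt 2 * ((2 : ℝ) ^ 60 / 20)) / 2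
    | some s => (Fintype.card {e // p e = some s} : ℝ) / 30 + ∑ W ∈ bad s y,
        (((Finset.univ : Finset {e // p e = some s}).filter fun e => src e.1 ∈ W.1 ∨ dst e.1 ∈ W.2).card : ℝ)
  have hX : ∀ c (σ : α → ℝ) (φ : β → ℝ), (∀ i, σ i = 1 ∨ σ i = -1) → (∀ k, φ k = 1 ∨ φ k = -1) →
      σ ⬝ᵥ (MpT y c *ᵥ φ) ≤ X c := by
    intro c σ φ hσ hφ
    cases c with
    | none => exact hR σ φ hσ hφ
    | some s => exact ((hpack s).1 y σ φ hσ hφ).le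
  ------------------------------------------------------------------
  -- the budget
  ------------------------------------------------------------------
  have hmreal : (2 : ℝ) ^ 60 ≤ m := by
    have h1 : ((2 ^ 60 * n : ℕ) : ℝ) ≤ m := by exact_mod_cast hm
    have h2 : (1 : ℝ) ≤ n := by exact_mod_cast hn
    push_cast at h1
    have h3 : (2 : ℝ) ^ 60 * 1 ≤ 2 ^ 60 * n := mul_le_mul_of_nonneg_left h2 (by norm_num)
    linarith only [h1, h3]
  have hspots : ∑ s : Fin r, (Fintype.card {e // p e = some s} : ℝ) ≤ 3 * m := by
    have h1 := sum_card_parts_le p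
    rw [Fintype.card_prod, Fintype.card_fin, Fintype.card_fin] at h1
    have h2 : ∀ s : Fin r, (Fintype.card {e // p e = some s} : ℝ)
        = ((Finset.univ.filter fun e => p e = some s).card : ℝ) := fun s => by rw [card_part_univ]
    simp only [h2]
    have h3 : ((∑ s : Fin r, (Finset.univ.filter fun e => p e = some s).card : ℕ) : ℝ) ≤ ((m * 3 : ℕ) : ℝ) := by
      exact_mod_cast h1
    push_cast at h3
    linarith only [h3]
  have hQ₀le : Q₀ ≤ 24 * m * Lc := by
    rw [hQ₀, ← Finset.sum_mul]
    refine mul_le_mul_of_nonneg_right ?_ hL10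
    have h1 : ∀ s : Fin r, 4 * (((V₁ s).card : ℝ) + (V₂ s).card)
        ≤ 8 * (Fintype.card {e // p e = some s} : ℝ) := by
      intro s
      have := hcov s
      rw [card_part_univ]
      have h' : (((V₁ s).card : ℝ) + (V₂ s).card) ≤ 2 * ((Finset.univ.filter fun e => p e = some s).card : ℝ) := by
        exact_mod_cast this
      linarith only [h']
    calc ∑ s, 4 * (((V₁ s).card : ℝ) + (V₂ s).card) ≤ ∑ s, 8 * (Fintype.card {e // p e = some s} : ℝ) :=
          Finset.sum_le_sum fun s _ => h1 s
      _ = 8 * ∑ s, (Fintype.card {e // p e = some s} : ℝ) := by rw [Finset.mul_sum]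
      _ ≤ 24 * m := by linarith only [hspots]
  have hA₃ : 6 / 5 * (Q₀ + 1) ≤ 0.001 * m + 1.2 := by
    have hm0 : (0 : ℝ) ≤ 24 * m := mul_nonneg (by norm_num) (Nat.cast_nonneg m)
    have h2 : Q₀ ≤ 24 * m * (1 / 28800) := hQ₀le.trans (mul_le_mul_of_nonneg_left hLc_le hm0)
    linarith only [h2]
  have hbud : ∑ c, X c < m := by
    rw [Fintype.sum_option]
    simp only [X]
    rw [Finset.sum_add_distrib]
    have h1 : ∑ s : Fin r, (Fintype.card {e // p e = some s} : ℝ) / 30 ≤ 0.1 * m := by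
      rw [← Finset.sum_div]; linarith only [hspots]
    have h2 : ∑ s : Fin r, ∑ W ∈ bad s y,
        (((Finset.univ : Finset {e // p e = some s}).filter fun e => src e.1 ∈ W.1 ∨ dst e.1 ∈ W.2).card : ℝ)
        < 6 / 5 * (Q₀ + 1) := hhatA
    linarith only [h1, h2, hbudR, hA₃, hmreal]
  ------------------------------------------------------------------
  -- free splitting
  ------------------------------------------------------------------
  refine cutCertified_of_matrix_cut_lt I y src dst own₁ own₂ hsrc hz ha hb
    (fun i k => ∑ e ∈ Finset.univ.filter (fun e : Fin m × Fin 3 => src e = i ∧ dst e = k),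
      ((boolSign (y e.1) : ℤ) : ℝ)) (fun i k => rfl) ?_
  intro σ' φ' hσ' hφ'
  have h := bilin_le_sum_of_parts src dst (fun e => ((boolSign (y e.1) : ℤ) : ℝ)) p _ (fun i k => rfl)
    (MpT y) (fun c i k => by rw [hMpT]) σ' φ' X (fun c => hX c σ' φ' hσ' hφ')
  exact lt_of_le_of_lt h hbud

end Summit.PneNP.PneNP.Theorems.SfmBl
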